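import Mathlib.GroupTheory.Perm.Cycle.Basic
import Mathlib.Data.Fintype.BigOperators
import Mathlib.Algebra.Order.BigOperators.Group.Finset
import HarnessLib

/-!
# Counting sections: twisted-invariant Boolean functions under a fixed-point-free permutation number at most `2^(n/2)`,
# and a union bound produces a function violating every one of fewer than `2^(n/2)` such constraint systems

COR-CM (cell `pub-hodgecm2`), binder seat b04 (gen 31), count-neutral own lane «Galois-CM-type classification»: the COMBINATORIAL
CORE of the quadratic (non-split) case of monotonicity (see `CorCM/GaloisCertificateQuotientLift` for degree `≥ 3` and
`CorCM/GaloisCertificateSplitTwo` for the split quadratic case).  KERNEL ONLY, Mathlib only: theorems; no definition, no named fact,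
no `sorry`.

WHY.  For a quadratic extension `G → Q` with central kernel `{1, n}` and a BAD quotient `(Q, c̄, T₀)`, the lifted CM sets of fibre
pattern `𝟙_{T₀} + 𝟙_{T₀ w}` are parametrised by SECTIONS `ε : D₁ → Bool` over `D₁ = T₀ ∖ T₀ w` (which of the two points of each
fibre is taken), they are all degenerate, and an element `v ∈ G` off the kernel and off `c·kernel` stabilises the set attached to
`ε` only if `ε(ψ_v z) = ε(z) ⊻ τ_v(z)` for all `z ∈ D₁`, where `ψ_v` is a FIXED-POINT-FREE permutation of `D₁` (`z ↦ v̄z` or `c̄v̄z`)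
and `τ_v` a fixed twist.  This file shows that such constraint systems have few solutions and that, when `|G| · 2^{|D₁|/2} < 2^{|D₁|}`,
some `ε` violates all of them — the counting step of «BAD ascends along every quadratic extension of a Galois CM field of degree
`≥ 64`» (the group-theoretic and field-theoretic assembly is left to the sequel files named in the seat's A7-JUNCTION notes).

* `eq_of_sameCycle_of_invariant` — a `ψ`-invariant function is constant on `ψ`-cycles.
* **`card_filter_invariant_le`** — `#{δ : α → Bool | δ ∘ ψ = δ} ≤ 2^(|α|/2)` for `ψ` a permutation without fixed points (an invariant
  function factors through the cycle quotient, which has at most `|α|/2` classes since every class contains `z ≠ ψ z`).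
* **`card_filter_twisted_le`** — the same bound for the affine systems `ε(ψ z) = ε(z) ⊻ τ(z)` (two solutions differ by an invariant
  function); stated for an injective fixed-point-free MAP `ψ : α → α` of a finite type.
* **`exists_forall_violated`** — if `|V| · 2^(|α|/2) < 2^|α|` then some `ε` violates, for every `v ∈ V`, some constraint of the
  `v`-th system.

## References

* [Kubota1965] T. Kubota, *On the field extension by complex multiplication*, Trans. AMS 118 (1965), §2 (rank and degenerate types —
  the context; the lemmas themselves are elementary counting). 
-/

namespace Summit.HodgeConjecture.CorCM.GaloisModels.SectionCount

open Finset

variable {α : Type*} [Fintype α] [DecidableEq α]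

omit [Fintype α] [DecidableEq α] in
/-- A `ψ`-invariant function takes the same value along `ψ`-cycles. [folklore] -/
theorem eq_of_sameCycle_of_invariant (ψ : Equiv.Perm α) (δ : α → Bool) (hδ : ∀ z, δ (ψ z) = δ z) {x y : α}
    (h : ψ.SameCycle x y) : δ x = δ y := by
  obtain ⟨i, rfl⟩ := h
  -- `δ ((ψ ^ i) x) = δ x` for every integer `i`
  have hnat : ∀ (k : ℕ) (z : α), δ ((ψ ^ k) z) = δ z := by
    intro k
    induction k with
    | zero => intro z; simp
    | succ k ih => intro z; rw [pow_succ', Equiv.Perm.mul_apply, hδ, ih]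
  induction i using Int.induction_on with
  | zero => simp
  | succ k _ =>
    have : (ψ ^ ((k : ℤ) + 1)) x = (ψ ^ (k + 1)) x := by rw [← zpow_natCast]; norm_cast
    rw [this, hnat]
  | pred k _ =>
    -- negative powers: `δ ((ψ^(k+1))⁻¹ x) = δ x` from the positive case applied to `(ψ^(k+1))⁻¹ x`
    have h1 : (ψ ^ (-(k : ℤ) - 1)) x = (ψ ^ (k + 1)).symm x := by
      rw [show (-(k : ℤ) - 1) = -((k + 1 : ℕ) : ℤ) by push_cast; ring, zpow_neg, zpow_natCast]; rfl
    rw [h1]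
    have h2 := hnat (k + 1) ((ψ ^ (k + 1)).symm x)
    rw [Equiv.apply_symm_apply] at h2
    exact h2

/-- **Invariant Boolean functions under a fixed-point-free permutation number at most `2^(|α|/2)`**: they factor through the
cycle quotient, and every cycle class has at least two elements. [folklore] -/
theorem card_filter_invariant_le (ψ : Equiv.Perm α) (hfix : ∀ z, ψ z ≠ z) :
    (Finset.univ.filter fun δ : α → Bool => ∀ z, δ (ψ z) = δ z).card ≤ 2 ^ (Fintype.card α / 2) := by
  classical
  -- the cycle quotient
  let S : Setoid α := ⟨ψ.SameCycle, ⟨fun x => Equiv.Perm.SameCycle.refl ψ x, fun h => h.symm, fun h₁ h₂ => h₁.trans h₂⟩⟩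
  let π : α → Quotient S := Quotient.mk S
  -- (1) invariant functions inject into functions on the quotient
  have hinj : ((Finset.univ.filter fun δ : α → Bool => ∀ z, δ (ψ z) = δ z).card) ≤ Fintype.card (Quotient S → Bool) := by
    rw [← Fintype.card_coe]
    refine Fintype.card_le_of_injective
      (fun δ => Quotient.lift (δ.1 : α → Bool) (fun x y (h : ψ.SameCycle x y) =>
        eq_of_sameCycle_of_invariant ψ δ.1 (Finset.mem_filter.1 δ.2).2 h)) ?_
    intro δ₁ δ₂ h
    apply Subtype.ext
    funext z
    have := congrFun h (π z)
    simpa [π] using this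
  -- (2) the quotient has at most `|α|/2` elements: every fibre of `π` contains `z` and `ψ z ≠ z`
  have hfib : ∀ q : Quotient S, 2 ≤ (Finset.univ.filter fun z : α => π z = q).card := by
    intro q
    obtain ⟨z, rfl⟩ := Quotient.exists_rep q
    refine Finset.one_lt_card.2 ⟨z, ?_, ψ z, ?_, (hfix z).symm⟩
    · simp [π]
    · simp only [Finset.mem_filter, Finset.mem_univ, true_and, π]
      exact Quotient.sound (⟨-1, by simp⟩ : ψ.SameCycle (ψ z) z)
  have hcardQ : 2 * Fintype.card (Quotient S) ≤ Fintype.card α := by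
    have hsum : (Finset.univ : Finset α).card = ∑ q ∈ (Finset.univ : Finset (Quotient S)),
        (Finset.univ.filter fun z : α => π z = q).card :=
      Finset.card_eq_sum_card_fiberwise fun z _ => Finset.mem_univ (π z)
    rw [← Finset.card_univ, ← Finset.card_univ, hsum]
    calc 2 * (Finset.univ : Finset (Quotient S)).card = ∑ _q ∈ (Finset.univ : Finset (Quotient S)), 2 := by
          rw [Finset.sum_const, smul_eq_mul, mul_comm]
      _ ≤ _ := Finset.sum_le_sum fun q _ => hfib q
  calc ((Finset.univ.filter fun δ : α → Bool => ∀ z, δ (ψ z) = δ z).card)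
      ≤ Fintype.card (Quotient S → Bool) := hinj
    _ = 2 ^ Fintype.card (Quotient S) := by rw [Fintype.card_fun, Fintype.card_bool]
    _ ≤ 2 ^ (Fintype.card α / 2) := Nat.pow_le_pow_right (by norm_num) (by omega)

/-- **The twisted systems `ε(ψ z) = ε(z) ⊻ τ(z)` have at most `2^(|α|/2)` solutions** (`ψ : α → α` injective without fixed
points): two solutions differ by a `ψ`-invariant function. [folklore] -/
theorem card_filter_twisted_le (ψ : α → α) (hinj : Function.Injective ψ) (hfix : ∀ z, ψ z ≠ z) (τ : α → Bool) :
    (Finset.univ.filter fun ε : α → Bool => ∀ z, ε (ψ z) = xor (ε z) (τ z)).card ≤ 2 ^ (Fintype.card α / 2) := by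
  classical
  set Sol := Finset.univ.filter fun ε : α → Bool => ∀ z, ε (ψ z) = xor (ε z) (τ z) with hSol
  by_cases hne : Sol = ∅
  · rw [hne, Finset.card_empty]; exact Nat.zero_le _
  obtain ⟨ε₀, hε₀⟩ := Finset.nonempty_iff_ne_empty.2 hne
  have hε₀' : ∀ z, ε₀ (ψ z) = xor (ε₀ z) (τ z) := (Finset.mem_filter.1 hε₀).2
  -- the permutation
  let Ψ : Equiv.Perm α := Equiv.ofBijective ψ (Finite.injective_iff_bijective.1 hinj)
  have hΨ : ∀ z, Ψ z = ψ z := fun z => rfl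
  -- `ε ↦ ε ⊻ ε₀` maps solutions injectively to invariant functions
  have hmap : ∀ ε ∈ Sol, (fun z => xor (ε z) (ε₀ z)) ∈
      (Finset.univ.filter fun δ : α → Bool => ∀ z, δ (Ψ z) = δ z) := by
    intro ε hε
    have hε' : ∀ z, ε (ψ z) = xor (ε z) (τ z) := (Finset.mem_filter.1 hε).2
    simp only [Finset.mem_filter, Finset.mem_univ, true_and, hΨ]
    intro z
    rw [hε' z, hε₀' z]
    cases ε z <;> cases ε₀ z <;> cases τ z <;> rfl
  calc Sol.card ≤ (Finset.univ.filter fun δ : α → Bool => ∀ z, δ (Ψ z) = δ z).card := by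
        refine Finset.card_le_card_of_injOn (fun ε => fun z => xor (ε z) (ε₀ z)) hmap ?_
        intro ε₁ _ ε₂ _ h
        funext z
        have := congrFun h z
        simp only at this
        cases h1 : ε₁ z <;> cases h2 : ε₂ z <;> cases h0 : ε₀ z <;> simp_all
    _ ≤ 2 ^ (Fintype.card α / 2) := card_filter_invariant_le Ψ (fun z => by rw [hΨ]; exact hfix z)

/-- **UNION BOUND: a function violating every system.**  If `|V| · 2^(|α|/2) < 2^|α|`, then some `ε : α → Bool` violates, for
every `v ∈ V`, at least one constraint `ε(ψ_v z) = ε(z) ⊻ τ_v(z)` (each `ψ_v` injective without fixed points). [folklore] -/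
theorem exists_forall_violated {ι : Type*} (V : Finset ι) (ψ : ι → α → α) (hinj : ∀ v ∈ V, Function.Injective (ψ v))
    (hfix : ∀ v ∈ V, ∀ z, ψ v z ≠ z) (τ : ι → α → Bool)
    (hbig : V.card * 2 ^ (Fintype.card α / 2) < 2 ^ Fintype.card α) :
    ∃ ε : α → Bool, ∀ v ∈ V, ∃ z, ε (ψ v z) ≠ xor (ε z) (τ v z) := by
  classical
  by_contra H
  -- every `ε` solves some system
  have hcover : (Finset.univ : Finset (α → Bool)) ⊆
      V.biUnion fun v => Finset.univ.filter fun ε : α → Bool => ∀ z, ε (ψ v z) = xor (ε z) (τ v z) := by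
    intro ε _
    rw [Finset.mem_biUnion]
    by_contra h
    refine H ⟨ε, fun v hv => ?_⟩
    by_contra h'
    refine h ⟨v, hv, Finset.mem_filter.2 ⟨Finset.mem_univ _, fun z => ?_⟩⟩
    by_contra h''
    exact h' ⟨z, h''⟩
  have h1 := Finset.card_le_card hcover
  have h2 : (V.biUnion fun v => Finset.univ.filter fun ε : α → Bool => ∀ z, ε (ψ v z) = xor (ε z) (τ v z)).card ≤
      V.card * 2 ^ (Fintype.card α / 2) := by
    refine (Finset.card_biUnion_le).trans ?_
    rw [mul_comm]
    calc ∑ v ∈ V, (Finset.univ.filter fun ε : α → Bool => ∀ z, ε (ψ v z) = xor (ε z) (τ v z)).card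
        ≤ ∑ _v ∈ V, 2 ^ (Fintype.card α / 2) := Finset.sum_le_sum fun v hv => card_filter_twisted_le (ψ v) (hinj v hv) (hfix v hv) (τ v)
      _ = 2 ^ (Fintype.card α / 2) * V.card := by rw [Finset.sum_const, smul_eq_mul, mul_comm]
  rw [Finset.card_univ, Fintype.card_fun, Fintype.card_bool] at h1
  omega

end Summit.HodgeConjecture.CorCM.GaloisModels.SectionCount
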